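import Summits.BirchSwinnertonDyer.BirchSwinnertonDyer.Theorems.PrintCf2SplitBadTwoLineDoubleCosetFrame
import Summits.BirchSwinnertonDyer.BirchSwinnertonDyer.Theorems.PrintCf2SplitBadTwoLineNoSplitPrimes
import Summits.BirchSwinnertonDyer.BirchSwinnertonDyer.Theorems.EisensteinPrimesAnomalousLocalMover
import HarnessLib

/-!
# Crux `PrintCf2.SplitBadTwoRankOneOfFacts` (stmt-BirchSwinnertonDyer-20368), road α v13 — (DC) part 4:
# THE PLACES OF `K_∞` ABOVE A PLACE `w` OF `K` AS THE DOUBLE-COSET SPACE `ker κ \ Γ_K / D_w` — FINITE, with representatives `γⁿ`, `n < p^m`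

Cell `bsd-print-cf2`, EXTRA WIDTH seat `bsd-line-cf2-p1-w8` g4 (prover-bsd-line-cf2-p1-w8-g4-0); LEAD cf2-p1 g13 ASSIGN 02:30:44Z «(DC) … the finitely many
`𝔓 ∣ v̄` in `K*_∞` as an index set with `Γ*`-action» — here for EVERY place `w` of `K`. `--supports stmt-BirchSwinnertonDyer-20368` (helper, Theses-free).
HONEST FRAMING: pure group theory plus two tree inputs; nothing here closes the crux or a registered stub; BSD is not proved by any of this; no summit
`Statement.lean` is touched; no `sorry`, no new axiom, no Literature fact, no definition.

For a `ℤ_p`-line `κ : Γ_K ↠ ℤ_p` with kernel `Gal(K̄/K_∞)`, a CLOSED subgroup `S ≤ Γ_K` containing some `τ₁` with `κ τ₁ ≠ 1` (`m := v_p(κ τ₁)`) and a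
topological generator `γ`, every `σ ∈ Γ_K` is `h · γⁿ · τ` with `h ∈ ker κ`, `n < p^m`, `τ ∈ S` (§1, the mirror image of part 1's (DC-1)); hence the
double-coset space `ker κ \ Γ_K / S` (Mathlib `DoubleCoset.Quotient`) is the image of `{γⁿ : n < p^m}` — FINITE of cardinality `≤ p^m`, a SINGLETON when
`κ τ₁` is a unit. For `S = D_w` the decomposition group of a place `w` this is the classical index set of the places of `K_∞` above `w`
[cite: NeukirchANT1999, Ch. I §9 p. 54 (primes above `𝔭` in `L` ↔ double cosets `H \ G / G_𝔓`)]; on the road-α line `κ'` (unramified outside `v̄`, `K`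
imaginary quadratic, `2 = v v̄`) NO place of `K` splits completely (-w8 g2 `LineDecomposition.decomp_not_le_kerSubgroup_of_isUnramifiedOutside` for
`w ≠ v̄`; total ramification at `v̄`, part 2), so EVERY `w` has finitely many places above it in `K*_∞`, and `v̄` exactly one.
* §1 `exists_eq_kerSubgroup_mul_pow_mul`, `exists_lt_doubleCoset_mk_eq`, `finite_doubleCosetQuotient`, `natCard_doubleCosetQuotient_le`,
  `subsingleton_doubleCosetQuotient_of_isUnit`; §2 `finite_doubleCosetQuotient_decomp_of_not_le` (closedness of `D_w`: bsd-eis `AnomalousLocalTorsion.isClosed_decomp`);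
  §3 `finite_doubleCosetQuotient_decomp_of_line` (`w ≠ v̄`, `W`-free), `subsingleton_doubleCosetQuotient_decomp_vbar_of_frame`,
  `finite_doubleCosetQuotient_decomp_of_frame` (every `w`); §4 (appended) the exact count `natCard_doubleCosetQuotient_eq : # = p^m` when
  `κ(S) = p^m ℤ_p` (`doubleCoset_mk_pow_injective/bijective`, `exists_mem_minimal_valuation`, `exists_natCard_doubleCosetQuotient_eq_pow`).
[cite: NeukirchANT1999, Ch. I §9 p. 54] [cite: Washington1997, §13.1–13.2] [cite: GreenbergVatsal2000, §2 pp. 16–17]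
-/

noncomputable section

set_option linter.dupNamespace false
set_option autoImplicit false

open scoped Classical

open NumberField IsDedekindDomain Field WeierstrassCurve
open Literature.NumberTheory.EllipticCurves Literature.NumberTheory.EllipticCurves.GreenbergSelmer
open Literature.NumberTheory.GaloisRepresentations
open Summit.BirchSwinnertonDyer.BirchSwinnertonDyer.Theorems.AnomalousLocalTorsion

namespace Summit.BirchSwinnertonDyer.BirchSwinnertonDyer.Theorems.PrintCf2.LineDoubleCoset

/-! ## §1. `Γ_K = ker κ · γ^{[0, p^m)} · S` for a closed `S` on which `κ` is non-trivial; the double-coset space `ker κ \ Γ_K / S` -/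

section Generic

variable {K : Type} [Field K] [NumberField K] {p : ℕ} [Fact p.Prime] (κ : ZpExtension K p)

/-- **Every `σ ∈ Γ_K` is `h · γⁿ · τ` with `h ∈ Gal(K̄/K_∞) = ker κ`, `n < p^m`, `τ ∈ S`**, for a closed subgroup `S ≤ Γ_K` containing `τ₁` with
`κ τ₁ ≠ 1` (valuation `m`) and a topological generator `γ`: write `κ σ = n + p^m y` with `n = appr_m(κ σ) < p^m`, pick `τ ∈ S` with `κ τ = p^m y`
(the closed subgroup `κ(S) ∋ κ τ₁` contains `p^m ℤ_p`; bsd-eis `exists_mem_apply_toAdd_eq_of_dvd`), and put `h := σ τ⁻¹ γ⁻ⁿ`.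
[cite: Washington1997, §13.1–13.2] [cite: NeukirchANT1999, Ch. I §9 p. 54] -/
theorem exists_eq_kerSubgroup_mul_pow_mul (S : Subgroup (absoluteGaloisGroup K)) (hS : IsClosed (S : Set (absoluteGaloisGroup K)))
    {τ₁ : absoluteGaloisGroup K} (hτ₁ : τ₁ ∈ S) (hne : κ τ₁ ≠ 1) {γ : absoluteGaloisGroup K} (hγ : κ.IsTopGenerator γ)
    (σ : absoluteGaloisGroup K) :
    ∃ (h : absoluteGaloisGroup K) (n : ℕ) (τ : absoluteGaloisGroup K),
      h ∈ κ.kerSubgroup ∧ n < p ^ ((κ τ₁).toAdd).valuation ∧ τ ∈ S ∧ σ = h * γ ^ n * τ := by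
  set m : ℕ := ((κ τ₁).toAdd).valuation with hm
  set a : ℤ_[p] := (κ σ).toAdd with ha
  have hdvd : (p : ℤ_[p]) ^ m ∣ a - (PadicInt.appr a m : ℤ_[p]) := Ideal.mem_span_singleton.mp (PadicInt.appr_spec m a)
  obtain ⟨τ, hτS, hτ⟩ := exists_mem_apply_toAdd_eq_of_dvd κ S hS hτ₁ hne hdvd
  refine ⟨σ * τ⁻¹ * (γ ^ PadicInt.appr a m)⁻¹, PadicInt.appr a m, τ, ?_, PadicInt.appr_lt a m, hτS, by group⟩
  rw [ZpExtension.mem_kerSubgroup, map_mul, map_mul, map_inv, map_inv, map_pow, hγ]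
  apply Multiplicative.toAdd.injective
  rw [toAdd_mul, toAdd_mul, toAdd_inv, toAdd_inv, toAdd_pow, toAdd_ofAdd, hτ, toAdd_one, ← ha]
  simp only [nsmul_eq_mul, mul_one]
  ring

/-- **The double coset `ker κ · σ · S` is `ker κ · γⁿ · S` for some `n < p^m`.** [cite: NeukirchANT1999, Ch. I §9 p. 54] -/
theorem exists_lt_doubleCoset_mk_eq (S : Subgroup (absoluteGaloisGroup K)) (hS : IsClosed (S : Set (absoluteGaloisGroup K)))
    {τ₁ : absoluteGaloisGroup K} (hτ₁ : τ₁ ∈ S) (hne : κ τ₁ ≠ 1) {γ : absoluteGaloisGroup K} (hγ : κ.IsTopGenerator γ)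
    (σ : absoluteGaloisGroup K) :
    ∃ n < p ^ ((κ τ₁).toAdd).valuation, DoubleCoset.mk κ.kerSubgroup S σ = DoubleCoset.mk κ.kerSubgroup S (γ ^ n) := by
  obtain ⟨h, n, τ, hh, hn, hτ, hσ⟩ := exists_eq_kerSubgroup_mul_pow_mul κ S hS hτ₁ hne hγ σ
  exact ⟨n, hn, ((DoubleCoset.eq κ.kerSubgroup S (γ ^ n) σ).mpr ⟨h, hh, τ, hτ, hσ⟩).symm⟩

/-- **`n ↦ ker κ · γⁿ · S` maps `{n < p^m}` ONTO the double-coset space `ker κ \ Γ_K / S`.** [cite: NeukirchANT1999, Ch. I §9 p. 54] -/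
theorem doubleCoset_mk_pow_surjective (S : Subgroup (absoluteGaloisGroup K)) (hS : IsClosed (S : Set (absoluteGaloisGroup K)))
    {τ₁ : absoluteGaloisGroup K} (hτ₁ : τ₁ ∈ S) (hne : κ τ₁ ≠ 1) {γ : absoluteGaloisGroup K} (hγ : κ.IsTopGenerator γ) :
    Function.Surjective (fun n : Fin (p ^ ((κ τ₁).toAdd).valuation) ↦
      (DoubleCoset.mk κ.kerSubgroup S (γ ^ (n : ℕ)) : DoubleCoset.Quotient (κ.kerSubgroup : Set (absoluteGaloisGroup K)) S)) := by
  intro q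
  induction q using Quotient.inductionOn' with
  | h σ =>
    obtain ⟨n, hn, hq⟩ := exists_lt_doubleCoset_mk_eq κ S hS hτ₁ hne hγ σ
    exact ⟨⟨n, hn⟩, hq.symm⟩

/-- **The double-coset space `ker κ \ Γ_K / S` is FINITE** (closed `S` on which `κ` is non-trivial). For `S = D_w` this is the finiteness of the set of
places of `K_∞` above `w`. [cite: NeukirchANT1999, Ch. I §9 p. 54] [cite: Washington1997, §13.1] -/
theorem finite_doubleCosetQuotient (S : Subgroup (absoluteGaloisGroup K)) (hS : IsClosed (S : Set (absoluteGaloisGroup K)))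
    {τ₁ : absoluteGaloisGroup K} (hτ₁ : τ₁ ∈ S) (hne : κ τ₁ ≠ 1) :
    Finite (DoubleCoset.Quotient (κ.kerSubgroup : Set (absoluteGaloisGroup K)) S) := by
  obtain ⟨γ, hγ⟩ := κ.surjective (Multiplicative.ofAdd 1)
  exact Finite.of_surjective _ (doubleCoset_mk_pow_surjective κ S hS hτ₁ hne hγ)

/-- **`#(ker κ \ Γ_K / S) ≤ p^m`**, `m = v_p(κ τ₁)`. [cite: NeukirchANT1999, Ch. I §9 p. 54] -/
theorem natCard_doubleCosetQuotient_le (S : Subgroup (absoluteGaloisGroup K)) (hS : IsClosed (S : Set (absoluteGaloisGroup K)))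
    {τ₁ : absoluteGaloisGroup K} (hτ₁ : τ₁ ∈ S) (hne : κ τ₁ ≠ 1) :
    Nat.card (DoubleCoset.Quotient (κ.kerSubgroup : Set (absoluteGaloisGroup K)) S) ≤ p ^ ((κ τ₁).toAdd).valuation := by
  obtain ⟨γ, hγ⟩ := κ.surjective (Multiplicative.ofAdd 1)
  simpa only [Nat.card_eq_fintype_card, Fintype.card_fin] using
    Nat.card_le_card_of_surjective _ (doubleCoset_mk_pow_surjective κ S hS hτ₁ hne hγ)

/-- **If `κ τ₁` is a UNIT for some `τ₁ ∈ S` then `ker κ \ Γ_K / S` is a SINGLETON** (`m = 0`): `Γ_K = ker κ · S`. For `S = D_w`: exactly ONE place of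
`K_∞` above `w` (e.g. `w` totally ramified in `K_∞`). [cite: NeukirchANT1999, Ch. I §9 p. 54] [cite: Washington1997, §13.1] -/
theorem subsingleton_doubleCosetQuotient_of_isUnit (S : Subgroup (absoluteGaloisGroup K)) (hS : IsClosed (S : Set (absoluteGaloisGroup K)))
    {τ₁ : absoluteGaloisGroup K} (hτ₁ : τ₁ ∈ S) (hu : IsUnit (κ τ₁).toAdd) :
    Subsingleton (DoubleCoset.Quotient (κ.kerSubgroup : Set (absoluteGaloisGroup K)) S) := by
  obtain ⟨u, hu⟩ := hu
  have key : ∀ σ : absoluteGaloisGroup K,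
      (DoubleCoset.mk κ.kerSubgroup S σ : DoubleCoset.Quotient (κ.kerSubgroup : Set (absoluteGaloisGroup K)) S) =
        DoubleCoset.mk κ.kerSubgroup S 1 := by
    intro σ
    obtain ⟨τ, hτS, hτ⟩ := exists_mem_apply_eq_ofAdd_mul κ S hS hτ₁ ((κ σ).toAdd * ((u⁻¹ : ℤ_[p]ˣ) : ℤ_[p]))
    refine ((DoubleCoset.eq κ.kerSubgroup S 1 σ).mpr ⟨σ * τ⁻¹, ?_, τ, hτS, by group⟩).symm
    rw [ZpExtension.mem_kerSubgroup, map_mul, map_inv, hτ, ← hu, mul_assoc, Units.inv_mul, mul_one, ofAdd_toAdd, mul_inv_cancel]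
  constructor
  intro a b
  induction a using Quotient.inductionOn' with
  | h σ =>
    induction b using Quotient.inductionOn' with
    | h σ' =>
      change DoubleCoset.mk κ.kerSubgroup S σ = DoubleCoset.mk κ.kerSubgroup S σ'
      rw [key σ, key σ']

end Generic

/-! ## §2. `S = D_w`: the places of `K_∞` above a place `w` of `K` -/

section Places

variable {K : Type} [Field K] [NumberField K] {p : ℕ} [Fact p.Prime] (κ : ZpExtension K p)

/-- **If `w` does NOT split completely in `K_∞` (`D_w ⊄ ker κ`) then `K_∞` has FINITELY many places above `w`**: the double-coset space
`ker κ \ Γ_K / D_w` is finite. [cite: NeukirchANT1999, Ch. I §9 p. 54] [cite: Washington1997, §13.1] -/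
theorem finite_doubleCosetQuotient_decomp_of_not_le {w : HeightOneSpectrum (𝓞 K)} (hD : ¬ GreenbergSelmer.decomp w ≤ κ.kerSubgroup) :
    Finite (DoubleCoset.Quotient (κ.kerSubgroup : Set (absoluteGaloisGroup K)) (GreenbergSelmer.decomp w)) := by
  obtain ⟨τ₁, hτ₁, hnot⟩ := SetLike.not_le_iff_exists.mp hD
  exact finite_doubleCosetQuotient κ (GreenbergSelmer.decomp w) (isClosed_decomp w) hτ₁
    (fun h ↦ hnot (by rwa [ZpExtension.mem_kerSubgroup]))

/-- **If `κ` takes a UNIT value on the inertia group `I_w` (so `w` is totally ramified in `K_∞`) then `K_∞` has exactly ONE place above `w`**: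
`ker κ \ Γ_K / D_w` is a singleton. [cite: NeukirchANT1999, Ch. I §9 p. 54] [cite: Washington1997, §13.1] -/
theorem subsingleton_doubleCosetQuotient_decomp_of_isUnit {w : HeightOneSpectrum (𝓞 K)} {τ₁ : absoluteGaloisGroup K}
    (hτ₁ : τ₁ ∈ GreenbergSelmer.inertia w) (hu : IsUnit (κ τ₁).toAdd) :
    Subsingleton (DoubleCoset.Quotient (κ.kerSubgroup : Set (absoluteGaloisGroup K)) (GreenbergSelmer.decomp w)) :=
  subsingleton_doubleCosetQuotient_of_isUnit κ (GreenbergSelmer.decomp w) (isClosed_decomp w) (GreenbergSelmer.inertia_le_decomp w hτ₁) hu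

end Places

/-! ## §3. The road-α line: every place of `K` has finitely many places above it in `K*_∞`, `v̄` exactly one -/

section Frame

variable {K : Type} [Field K] [NumberField K]

/-- **On the `v̄`-line of an imaginary quadratic `K` with `p = v v̄` split (`κ` unramified outside `v̄`), every place `w ≠ v̄` of `K` has FINITELY many
places above it in `K_∞`** — no such place splits completely (-w8 g2 `LineDecomposition.decomp_not_le_kerSubgroup_of_isUnramifiedOutside`). `W`-free.
[cite: NeukirchANT1999, Ch. I §9 p. 54] [cite: Washington1997, §13.1] [cite: deShalit1987, II §1.9] -/
theorem finite_doubleCosetQuotient_decomp_of_line {p : ℕ} [Fact p.Prime] (hK : IsImaginaryQuadratic K)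
    {v vbar : HeightOneSpectrum (𝓞 K)} (hv : ((p : ℕ) : 𝓞 K) ∈ v.asIdeal) (hvbar : ((p : ℕ) : 𝓞 K) ∈ vbar.asIdeal) (hne : vbar ≠ v)
    (κ : ZpExtension K p) (hκ : κ.IsUnramifiedOutside vbar) {w : HeightOneSpectrum (𝓞 K)} (hw : w ≠ vbar) :
    Finite (DoubleCoset.Quotient (κ.kerSubgroup : Set (absoluteGaloisGroup K)) (GreenbergSelmer.decomp w)) :=
  finite_doubleCosetQuotient_decomp_of_not_le κ
    (LineDecomposition.decomp_not_le_kerSubgroup_of_isUnramifiedOutside hK hv hvbar hne κ hκ hw)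

/-- **On a road-α frame, `K*_∞` has exactly ONE place above `v̄`** (`ker κ' \ Γ_K / D_v̄` is a singleton): the line is totally ramified at `v̄`
(part 2 `exists_mem_inertia_isUnit_of_frame`). [cite: NeukirchANT1999, Ch. I §9 p. 54] [cite: deShalit1987, II §1.9] -/
theorem subsingleton_doubleCosetQuotient_decomp_vbar_of_frame {d : ℤ} (hd0 : d ≠ 0) (W : WeierstrassCurve ℚ) [W.IsElliptic]
    (C : VariableChange ℚ) (hC : C • W = cm7.quadraticTwist (d : ℚ)) (hK : IsImaginaryQuadratic K)
    {v vbar : HeightOneSpectrum (𝓞 K)} (hv : ((2 : ℕ) : 𝓞 K) ∈ v.asIdeal) (hvbar : ((2 : ℕ) : 𝓞 K) ∈ vbar.asIdeal) (hne : vbar ≠ v)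
    (π : (W.baseChange K).endRing) (hrel : (π : AddMonoid.End (W.baseChange K).geomPoints) * π = π - 2)
    (κ' : ZpExtension K 2) (hκ' : κ'.IsUnramifiedOutside vbar) :
    Subsingleton (DoubleCoset.Quotient (κ'.kerSubgroup : Set (absoluteGaloisGroup K)) (GreenbergSelmer.decomp vbar)) := by
  haveI : Fact (Nat.Prime 2) := ⟨Nat.prime_two⟩
  obtain ⟨τ₁, hτ₁, hu⟩ := exists_mem_inertia_isUnit_of_frame hd0 W C hC hK hv hvbar hne π hrel κ' hκ'
  exact subsingleton_doubleCosetQuotient_decomp_of_isUnit κ' hτ₁ hu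

/-- **On a road-α frame, EVERY place `w` of `K` has finitely many places above it in `K*_∞`** (`w ≠ v̄`: no complete splitting; `w = v̄`: one place).
[cite: NeukirchANT1999, Ch. I §9 p. 54] [cite: Washington1997, §13.1] -/
theorem finite_doubleCosetQuotient_decomp_of_frame {d : ℤ} (hd0 : d ≠ 0) (W : WeierstrassCurve ℚ) [W.IsElliptic]
    (C : VariableChange ℚ) (hC : C • W = cm7.quadraticTwist (d : ℚ)) (hK : IsImaginaryQuadratic K)
    {v vbar : HeightOneSpectrum (𝓞 K)} (hv : ((2 : ℕ) : 𝓞 K) ∈ v.asIdeal) (hvbar : ((2 : ℕ) : 𝓞 K) ∈ vbar.asIdeal) (hne : vbar ≠ v)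
    (π : (W.baseChange K).endRing) (hrel : (π : AddMonoid.End (W.baseChange K).geomPoints) * π = π - 2)
    (κ' : ZpExtension K 2) (hκ' : κ'.IsUnramifiedOutside vbar) (w : HeightOneSpectrum (𝓞 K)) :
    Finite (DoubleCoset.Quotient (κ'.kerSubgroup : Set (absoluteGaloisGroup K)) (GreenbergSelmer.decomp w)) := by
  haveI : Fact (Nat.Prime 2) := ⟨Nat.prime_two⟩
  by_cases hw : w = vbar
  · subst hw
    haveI := subsingleton_doubleCosetQuotient_decomp_vbar_of_frame hd0 W C hC hK hv hvbar hne π hrel κ' hκ'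
    infer_instance
  · exact finite_doubleCosetQuotient_decomp_of_line hK hv hvbar hne κ' hκ' hw

end Frame

/-! ## §4. The exact count: `#(ker κ \ Γ_K / S) = p^m` when `κ(S) = p^m ℤ_p` -/

section Count

variable {K : Type} [Field K] [NumberField K] {p : ℕ} [Fact p.Prime] (κ : ZpExtension K p)

omit [NumberField K] in
/-- **`n ↦ ker κ · γⁿ · S` is INJECTIVE on `{n < p^m}` when `p^m` divides every value of `κ` on `S`** (`m = v_p(κ τ₁)` the minimal valuation):
`γ^b = h γ^a τ` gives `b = a + κ τ` in `ℤ_p`, so `p^m ∣ b − a` in `ℤ`, and `a, b < p^m`. [cite: NeukirchANT1999, Ch. I §9 p. 54] [cite: Washington1997, §13.1] -/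
theorem doubleCoset_mk_pow_injective (S : Subgroup (absoluteGaloisGroup K)) {τ₁ : absoluteGaloisGroup K}
    (hmin : ∀ τ ∈ S, (p : ℤ_[p]) ^ ((κ τ₁).toAdd).valuation ∣ (κ τ).toAdd) {γ : absoluteGaloisGroup K} (hγ : κ.IsTopGenerator γ) :
    Function.Injective (fun n : Fin (p ^ ((κ τ₁).toAdd).valuation) ↦
      (DoubleCoset.mk κ.kerSubgroup S (γ ^ (n : ℕ)) : DoubleCoset.Quotient (κ.kerSubgroup : Set (absoluteGaloisGroup K)) S)) := by
  set m : ℕ := ((κ τ₁).toAdd).valuation with hm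
  intro a b hab
  obtain ⟨h, hh, τ, hτ, heq⟩ := (DoubleCoset.eq κ.kerSubgroup S (γ ^ (a : ℕ)) (γ ^ (b : ℕ))).mp hab
  have hγ' : κ γ = Multiplicative.ofAdd 1 := hγ
  have hκ := congrArg (fun g ↦ (κ g).toAdd) heq
  simp only [map_mul, map_pow, hγ', toAdd_mul, toAdd_pow, toAdd_ofAdd, nsmul_eq_mul, mul_one,
    (ZpExtension.mem_kerSubgroup ..).mp hh, toAdd_one, zero_add] at hκ
  -- `hκ : (b : ℤ_[p]) = a + (κ τ).toAdd`
  have hdvd : (p : ℤ_[p]) ^ m ∣ (((b : ℕ) : ℤ) - ((a : ℕ) : ℤ) : ℤ) := by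
    have h1 : (((b : ℕ) : ℤ) - ((a : ℕ) : ℤ) : ℤ) = ((κ τ).toAdd : ℤ_[p]) := by
      push_cast
      rw [hκ]
      ring
    rw [h1]
    exact hmin τ hτ
  have hdvdZ : ((p : ℤ) ^ m) ∣ ((b : ℕ) : ℤ) - ((a : ℕ) : ℤ) :=
    PadicInt.norm_int_le_pow_iff_dvd.mp
      ((PadicInt.norm_le_pow_iff_mem_span_pow _ _).mpr (Ideal.mem_span_singleton.mpr hdvd))
  have hmod : (a : ℕ) ≡ (b : ℕ) [MOD p ^ m] := Nat.modEq_iff_dvd.mpr (by exact_mod_cast hdvdZ)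
  exact Fin.ext (hmod.eq_of_lt_of_lt a.2 b.2)

/-- **`n ↦ ker κ · γⁿ · S` is a BIJECTION `{n < p^m} ≃ ker κ \ Γ_K / S`** for a closed `S` with `κ(S) = p^m ℤ_p` (`τ₁ ∈ S` of minimal valuation `m`,
`p^m ∣ κ τ` for all `τ ∈ S`). For `S = D_w`: the places of `K_∞` above `w` are `γⁿ · w̃`, `n < p^m`, pairwise distinct.
[cite: NeukirchANT1999, Ch. I §9 p. 54] [cite: Washington1997, §13.1] -/
theorem doubleCoset_mk_pow_bijective (S : Subgroup (absoluteGaloisGroup K)) (hS : IsClosed (S : Set (absoluteGaloisGroup K)))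
    {τ₁ : absoluteGaloisGroup K} (hτ₁ : τ₁ ∈ S) (hne : κ τ₁ ≠ 1)
    (hmin : ∀ τ ∈ S, (p : ℤ_[p]) ^ ((κ τ₁).toAdd).valuation ∣ (κ τ).toAdd) {γ : absoluteGaloisGroup K} (hγ : κ.IsTopGenerator γ) :
    Function.Bijective (fun n : Fin (p ^ ((κ τ₁).toAdd).valuation) ↦
      (DoubleCoset.mk κ.kerSubgroup S (γ ^ (n : ℕ)) : DoubleCoset.Quotient (κ.kerSubgroup : Set (absoluteGaloisGroup K)) S)) :=
  ⟨doubleCoset_mk_pow_injective κ S hmin hγ, doubleCoset_mk_pow_surjective κ S hS hτ₁ hne hγ⟩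

/-- **`#(ker κ \ Γ_K / S) = p^m`** when `κ(S) = p^m ℤ_p`. For `S = D_w` on a `ℤ_p`-line: the number of places of `K_∞` above `w` is `p^{m_w}`,
`m_w` the minimal valuation of `κ` on `D_w` (`= v_p(κ(Frob_w))` at an unramified `w`, `= 0` at a totally ramified one).
[cite: NeukirchANT1999, Ch. I §9 p. 54] [cite: Washington1997, §13.1] -/
theorem natCard_doubleCosetQuotient_eq (S : Subgroup (absoluteGaloisGroup K)) (hS : IsClosed (S : Set (absoluteGaloisGroup K)))
    {τ₁ : absoluteGaloisGroup K} (hτ₁ : τ₁ ∈ S) (hne : κ τ₁ ≠ 1)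
    (hmin : ∀ τ ∈ S, (p : ℤ_[p]) ^ ((κ τ₁).toAdd).valuation ∣ (κ τ).toAdd) :
    Nat.card (DoubleCoset.Quotient (κ.kerSubgroup : Set (absoluteGaloisGroup K)) S) = p ^ ((κ τ₁).toAdd).valuation := by
  obtain ⟨γ, hγ⟩ := κ.surjective (Multiplicative.ofAdd 1)
  rw [← Nat.card_eq_of_bijective _ (doubleCoset_mk_pow_bijective κ S hS hτ₁ hne hmin hγ), Nat.card_eq_fintype_card, Fintype.card_fin]

omit [NumberField K] in
/-- **A minimal-valuation witness always exists**: for ANY subgroup `S` on which `κ` is non-trivial there is `τ₁ ∈ S` with `κ τ₁ ≠ 1`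
and `p^{v(κ τ₁)} ∣ κ τ` for every `τ ∈ S` (take `v(κ τ₁)` least). So `natCard_doubleCosetQuotient_eq` applies to every closed `S ⊄ ker κ`.
[cite: Washington1997, §13.1] -/
theorem exists_mem_minimal_valuation (S : Subgroup (absoluteGaloisGroup K)) {τ₀ : absoluteGaloisGroup K} (hτ₀ : τ₀ ∈ S) (hne : κ τ₀ ≠ 1) :
    ∃ τ₁ ∈ S, κ τ₁ ≠ 1 ∧ ∀ τ ∈ S, (p : ℤ_[p]) ^ ((κ τ₁).toAdd).valuation ∣ (κ τ).toAdd := by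
  classical
  have hex : ∃ n : ℕ, ∃ τ ∈ S, κ τ ≠ 1 ∧ ((κ τ).toAdd).valuation = n := ⟨_, τ₀, hτ₀, hne, rfl⟩
  obtain ⟨τ₁, hτ₁, hne₁, hval⟩ := Nat.find_spec hex
  refine ⟨τ₁, hτ₁, hne₁, fun τ hτ ↦ ?_⟩
  by_cases h1 : κ τ = 1
  · rw [h1, toAdd_one]
    exact dvd_zero _
  · have hτ0 : (κ τ).toAdd ≠ 0 := fun h ↦ h1 (by rw [← ofAdd_toAdd (κ τ), h]; rfl)
    have hle : ((κ τ₁).toAdd).valuation ≤ ((κ τ).toAdd).valuation := by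
      rw [hval]
      exact Nat.find_min' hex ⟨τ, hτ, h1, rfl⟩
    exact Ideal.mem_span_singleton.mp ((PadicInt.mem_span_pow_iff_le_valuation _ hτ0 _).mpr hle)

/-- **Hypothesis-free count**: for a closed `S ≤ Γ_K` not contained in `ker κ`, `#(ker κ \ Γ_K / S) = p^m` for the minimal valuation `m` of `κ` on `S`.
For `S = D_w`: the number of places of `K_∞` above a place `w` that does not split completely is a power of `p`. [cite: NeukirchANT1999, Ch. I §9 p. 54] -/
theorem exists_natCard_doubleCosetQuotient_eq_pow (S : Subgroup (absoluteGaloisGroup K)) (hS : IsClosed (S : Set (absoluteGaloisGroup K)))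
    (hD : ¬ S ≤ κ.kerSubgroup) :
    ∃ τ₁ ∈ S, κ τ₁ ≠ 1 ∧
      Nat.card (DoubleCoset.Quotient (κ.kerSubgroup : Set (absoluteGaloisGroup K)) S) = p ^ ((κ τ₁).toAdd).valuation := by
  obtain ⟨τ₀, hτ₀, hnot⟩ := SetLike.not_le_iff_exists.mp hD
  obtain ⟨τ₁, hτ₁, hne, hmin⟩ := exists_mem_minimal_valuation κ S hτ₀ (fun h ↦ hnot (by rwa [ZpExtension.mem_kerSubgroup]))
  exact ⟨τ₁, hτ₁, hne, natCard_doubleCosetQuotient_eq κ S hS hτ₁ hne hmin⟩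

end Count

end Summit.BirchSwinnertonDyer.BirchSwinnertonDyer.Theorems.PrintCf2.LineDoubleCoset

end
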